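/-
Origin: expansion seat `planner-pub-hodgecm-pv07-g2-0`, handover #7a 2026-08-18T06:39:50Z (`HOME/pub-hodgecm-pv07-g2/lean/Pv07g2/DilationOrd.lean`, md5 cefd3602, 255 lines);
landed by the gen-7 packager in gate run 25 as `HodgeCM/PerL34/LocalFactors/DilationOrd.lean` (import ^import Pv07g2\.→import HodgeCM.PerL34.LocalFactors. ×1).
-/
/-
Copyright: HodgeCM publication cell (pub-hodgecm), DAG node N31f/N31g — split places in the D4 dilation model
(prover lineage pv07, gen 2).  Released under the package licence.

# Uniformizers, `ord`, and the shell partition of `F^×` for a non-archimedean local field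

Source under adjudication (NOT cited; this file PROVES the place set-up facts it uses): PerL v5, Lemma 4.2(b),
proof, tex l. 629–630 — "`n = ord y`", the shells `ϖⁿ𝒪^×`, "`∫_{F_v^×} q_v^{-3|ord y|/2} νχ'(y) d^×y`
converges absolutely … since `Σ_n q_v^{-3|n|/2} < ∞`".

For a non-trivially normed, ultrametric, proper field `F` (= any non-archimedean local field) this file PROVES
the "place set-up data" that the group-level shell assembly (pv10 `UnramifiedFactors.split_*`, pv13-g3
`SplitShells`) takes as input:
* `exists_isUniformizer` — there is `ϖ ∈ F^×` with `‖ϖ‖ < 1` generating the norm group: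
  `∀ y ∈ F^×, ∃ k : ℤ, ‖y‖ = ‖ϖ‖ᵏ` (Mathlib: the valuation ring of a proper non-trivially normed
  ultrametric field is a DVR — `Valued.integer.isDiscreteValuationRing_of_compactSpace`);
* `IsUniformizer.ord : F^× →* Multiplicative ℤ` with `‖y‖ = ‖ϖ‖ ^ ord y`, `ord ϖ = 1`,
  `ker ord = {‖u‖ = 1} = 𝒪^×`, and `shell ϖ k = ord⁻¹{k}` (pv07-g2's norm shells ARE pv13-g3's `ord` shells);
* the shells `shell ϖ k = {‖y‖ = ‖ϖ‖ᵏ}` are measurable, pairwise disjoint, COVER `F^×`, `shell ϖ k = ϖᵏ • shell ϖ 0`,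
  and have the same left-Haar measure as `shell ϖ 0 = 𝒪^×` (`measure_shell_eq`);
* `IsUniformizer.norm_le_of_norm_lt_one` — `‖x‖ < 1 → ‖x‖ ≤ ‖ϖ‖` (so `ϖ𝒪` IS the maximal ideal and
  pv13-g3's `resIndex ϖ = [𝒪 : ϖ𝒪]` is the residue cardinality).
Nothing is cited; no hypothesis names PerL, QW8 or a 2001-programme claim.  Axioms = the standard trio.
Unit `pub-hodgecm-pv07-g2`, 2026-08-18.
-/
import Summits.HodgeConjecture.HodgeCM.PerL34.LocalFactors.DilationUnramified
import Mathlib.Topology.Algebra.Valued.LocallyCompact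

/-! PORT of `HodgeCM/PerL34/LocalFactors/DilationOrd.lean` (HodgeCMPerL run 82) — verbatim mechanical port; provenance in the PORT header line. -/

set_option autoImplicit false

noncomputable section

open MeasureTheory MeasureTheory.Measure Set Metric
open scoped NNReal ENNReal Pointwise

namespace HodgeCM
namespace PerL34
namespace LocalFactors
namespace DilationModel

section Ord

variable {F : Type} [NontriviallyNormedField F] [IsUltrametricDist F]

/-- **Uniformizer** (norm form): `‖ϖ‖ < 1` and the norm group of `F^×` is `‖ϖ‖^ℤ`. -/
def IsUniformizer (ϖ : Fˣ) : Prop :=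
  ‖(ϖ : F)‖ < 1 ∧ ∀ y : Fˣ, ∃ k : ℤ, ‖(y : F)‖ = ‖(ϖ : F)‖ ^ k

omit [IsUltrametricDist F] in
/-- (Ported verbatim from the HodgeCMPerL package; no docstring in the source.) -/
theorem norm_units_pos (y : Fˣ) : 0 < ‖(y : F)‖ := norm_pos_iff.mpr y.ne_zero

/-! ### Existence: the valuation ring of a local field is a DVR (Mathlib)

Only inside this section is the norm-induced `Valued F ℝ≥0` structure (`NormedField.toValued`) an instance;
`Valued.integer F` is the closed unit ball `𝒪 = {‖x‖ ≤ 1}` as a subring. -/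

section Existence

open scoped NormedField

/-- (Ported verbatim from the HodgeCMPerL package; no docstring in the source.) -/
theorem coe_integer_eq_closedBall : ((Valued.integer F : Subring F) : Set F) = closedBall (0 : F) 1 := by
  ext x; simp [Valued.integer.mem_iff]

/-- (Ported verbatim from the HodgeCMPerL package; no docstring in the source.) -/
theorem compactSpace_integer [ProperSpace F] : CompactSpace (Valued.integer F) :=
  isCompact_iff_compactSpace.mp (by rw [coe_integer_eq_closedBall]; exact isCompact_closedBall _ _)

/-- (Ported verbatim from the HodgeCMPerL package; no docstring in the source.) -/
theorem isDiscreteValuationRing_integer [ProperSpace F] : IsDiscreteValuationRing (Valued.integer F) := by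
  haveI : CompactSpace (Valued.integer F) := compactSpace_integer
  haveI : (Valued.v : Valuation F ℝ≥0).IsNontrivial :=
    (inferInstance : (NormedField.valuation (K := F)).RankOne).toIsNontrivial
  exact Valued.integer.isDiscreteValuationRing_of_compactSpace

/-- norms of integral elements: `x = u·ϖ₀ⁿ` with `‖u‖ = 1` -/
theorem exists_norm_eq_pow_of_norm_le_one [ProperSpace F] {ϖ₀ : Valued.integer F} (hirr : Irreducible ϖ₀)
    (y : F) (hy0 : y ≠ 0) (hy : ‖y‖ ≤ 1) : ∃ n : ℕ, ‖y‖ = ‖(ϖ₀ : F)‖ ^ n := by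
  haveI := isDiscreteValuationRing_integer (F := F)
  have hmem : y ∈ Valued.integer F := Valued.integer.mem_iff.mpr hy
  have hne : (⟨y, hmem⟩ : Valued.integer F) ≠ 0 := fun h => hy0 (congrArg Subtype.val h)
  obtain ⟨n, u, hu⟩ := IsDiscreteValuationRing.eq_unit_mul_pow_irreducible hne hirr
  refine ⟨n, ?_⟩
  have h := congrArg (fun z : Valued.integer F => ‖(z : F)‖) hu
  simp only at h
  rw [show ((((u : Valued.integer F) * ϖ₀ ^ n : Valued.integer F) : F)) = ((u : Valued.integer F) : F) * (ϖ₀ : F) ^ n by push_cast; rfl,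
    norm_mul, norm_pow, Valued.integer.norm_coe_unit, one_mul] at h
  exact h

/-- **Every non-archimedean local field has a uniformizer** (in the norm sense). -/
theorem exists_isUniformizer [ProperSpace F] : ∃ ϖ : Fˣ, IsUniformizer ϖ := by
  haveI := isDiscreteValuationRing_integer (F := F)
  obtain ⟨ϖ₀, hirr⟩ := IsDiscreteValuationRing.exists_irreducible (Valued.integer F)
  have h0 : (ϖ₀ : F) ≠ 0 := fun h => hirr.ne_zero (Subtype.ext h)
  refine ⟨Units.mk0 (ϖ₀ : F) h0, Valued.integer.norm_irreducible_lt_one hirr, fun y => ?_⟩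
  rw [Units.val_mk0]
  rcases le_or_gt ‖(y : F)‖ 1 with hy | hy
  · obtain ⟨n, hn⟩ := exists_norm_eq_pow_of_norm_le_one hirr (y : F) y.ne_zero hy
    exact ⟨n, by rw [zpow_natCast]; exact hn⟩
  · have hy' : ‖((y⁻¹ : Fˣ) : F)‖ ≤ 1 := by
      rw [Units.val_inv_eq_inv_val, norm_inv]; exact inv_le_one_of_one_le₀ hy.le
    obtain ⟨n, hn⟩ := exists_norm_eq_pow_of_norm_le_one hirr ((y⁻¹ : Fˣ) : F) (y⁻¹).ne_zero hy'
    refine ⟨-(n : ℤ), ?_⟩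
    rw [Units.val_inv_eq_inv_val, norm_inv] at hn
    rw [zpow_neg, zpow_natCast, ← hn, inv_inv]

end Existence

/-! ### `ord` -/

namespace IsUniformizer

variable {ϖ : Fˣ} (hϖ : IsUniformizer ϖ)
include hϖ

omit [IsUltrametricDist F] in
/-- (Ported verbatim from the HodgeCMPerL package; no docstring in the source.) -/
theorem norm_lt_one : ‖(ϖ : F)‖ < 1 := hϖ.1

omit [IsUltrametricDist F] in
/-- (Ported verbatim from the HodgeCMPerL package; no docstring in the source.) -/
theorem zpow_injective : Function.Injective fun k : ℤ => ‖(ϖ : F)‖ ^ k :=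
  zpow_right_injective₀ (norm_units_pos ϖ) hϖ.norm_lt_one.ne

omit [IsUltrametricDist F] in
/-- `ord y`: the unique `k` with `‖y‖ = ‖ϖ‖ᵏ` -/
theorem existsUnique_norm_eq_zpow (y : Fˣ) : ∃! k : ℤ, ‖(y : F)‖ = ‖(ϖ : F)‖ ^ k := by
  obtain ⟨k, hk⟩ := hϖ.2 y
  exact ⟨k, hk, fun k' hk' => hϖ.zpow_injective (hk'.symm.trans hk)⟩

/-- the valuation `ord : F^× → ℤ` attached to the uniformizer -/
def ordFun (y : Fˣ) : ℤ := (hϖ.2 y).choose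

omit [IsUltrametricDist F] in
/-- (Ported verbatim from the HodgeCMPerL package; no docstring in the source.) -/
theorem norm_eq_zpow_ordFun (y : Fˣ) : ‖(y : F)‖ = ‖(ϖ : F)‖ ^ hϖ.ordFun y := (hϖ.2 y).choose_spec

omit [IsUltrametricDist F] in
/-- (Ported verbatim from the HodgeCMPerL package; no docstring in the source.) -/
theorem ordFun_eq_iff (y : Fˣ) (k : ℤ) : hϖ.ordFun y = k ↔ ‖(y : F)‖ = ‖(ϖ : F)‖ ^ k :=
  ⟨fun h => h ▸ hϖ.norm_eq_zpow_ordFun y,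
    fun h => hϖ.zpow_injective ((hϖ.norm_eq_zpow_ordFun y).symm.trans h)⟩

omit [IsUltrametricDist F] in
/-- (Ported verbatim from the HodgeCMPerL package; no docstring in the source.) -/
theorem ordFun_mul (y z : Fˣ) : hϖ.ordFun (y * z) = hϖ.ordFun y + hϖ.ordFun z := by
  rw [ordFun_eq_iff, Units.val_mul, norm_mul, hϖ.norm_eq_zpow_ordFun y, hϖ.norm_eq_zpow_ordFun z,
    zpow_add₀ (norm_units_pos ϖ).ne']

omit [IsUltrametricDist F] in
/-- (Ported verbatim from the HodgeCMPerL package; no docstring in the source.) -/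
theorem ordFun_one : hϖ.ordFun 1 = 0 := by
  rw [ordFun_eq_iff, Units.val_one, norm_one, zpow_zero]

omit [IsUltrametricDist F] in
/-- (Ported verbatim from the HodgeCMPerL package; no docstring in the source.) -/
theorem ordFun_self : hϖ.ordFun ϖ = 1 := by
  rw [ordFun_eq_iff, zpow_one]

/-- **`ord : F^× →* Multiplicative ℤ`** (the shape pv13-g3's `SplitShells` takes as place data) -/
def ord : Fˣ →* Multiplicative ℤ where
  toFun y := Multiplicative.ofAdd (hϖ.ordFun y)
  map_one' := by rw [hϖ.ordFun_one]; rfl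
  map_mul' y z := by rw [hϖ.ordFun_mul, ofAdd_add]

omit [IsUltrametricDist F] in
/-- (Ported verbatim from the HodgeCMPerL package; no docstring in the source.) -/
theorem toAdd_ord (y : Fˣ) : (hϖ.ord y).toAdd = hϖ.ordFun y := rfl

omit [IsUltrametricDist F] in
/-- (Ported verbatim from the HodgeCMPerL package; no docstring in the source.) -/
theorem norm_eq_zpow_ord (y : Fˣ) : ‖(y : F)‖ = ‖(ϖ : F)‖ ^ (hϖ.ord y).toAdd := hϖ.norm_eq_zpow_ordFun y

omit [IsUltrametricDist F] in
/-- (Ported verbatim from the HodgeCMPerL package; no docstring in the source.) -/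
theorem ord_self : hϖ.ord ϖ = Multiplicative.ofAdd 1 := by
  change Multiplicative.ofAdd (hϖ.ordFun ϖ) = _; rw [hϖ.ordFun_self]

omit [IsUltrametricDist F] in
/-- `ker ord = 𝒪^× = {‖u‖ = 1}` -/
theorem ord_eq_one_iff (y : Fˣ) : hϖ.ord y = 1 ↔ ‖(y : F)‖ = 1 := by
  change Multiplicative.ofAdd (hϖ.ordFun y) = Multiplicative.ofAdd 0 ↔ _
  rw [Multiplicative.ofAdd.apply_eq_iff_eq, ordFun_eq_iff, zpow_zero]

omit [IsUltrametricDist F] in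
/-- **pv07-g2's norm shells ARE the `ord` shells**: `shell ϖ k = ord⁻¹{k}`. -/
theorem mem_shell_iff_ord (k : ℤ) (y : Fˣ) : y ∈ shell ϖ k ↔ (hϖ.ord y).toAdd = k := by
  rw [mem_shell_iff, toAdd_ord, ordFun_eq_iff]

omit [IsUltrametricDist F] in
/-- (Ported verbatim from the HodgeCMPerL package; no docstring in the source.) -/
theorem shell_eq_ord_preimage (k : ℤ) : shell ϖ k = {y | (hϖ.ord y).toAdd = k} :=
  Set.ext fun y => hϖ.mem_shell_iff_ord k y

omit [IsUltrametricDist F] in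
/-- the shells COVER `F^×` -/
theorem iUnion_shell : (⋃ k : ℤ, shell ϖ k) = univ :=
  eq_univ_of_forall fun y => mem_iUnion.mpr ⟨hϖ.ordFun y, hϖ.norm_eq_zpow_ordFun y⟩

omit [IsUltrametricDist F] in
/-- `‖x‖ < 1 → ‖x‖ ≤ ‖ϖ‖`: `ϖ𝒪 = {‖x‖ ≤ ‖ϖ‖}` is the maximal ideal `{‖x‖ < 1}`, so `[𝒪 : ϖ𝒪]` is the
residue cardinality. -/
theorem norm_le_of_norm_lt_one (x : F) (hx : ‖x‖ < 1) : ‖x‖ ≤ ‖(ϖ : F)‖ := by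
  by_cases hx0 : x = 0
  · rw [hx0, norm_zero]; exact (norm_nonneg _)
  · obtain ⟨k, hk⟩ := hϖ.2 (Units.mk0 x hx0)
    rw [Units.val_mk0] at hk
    rw [hk] at hx ⊢
    have hk1 : 0 < k := (zpow_lt_one_iff_right_of_lt_one₀ (norm_units_pos ϖ) hϖ.norm_lt_one).mp hx
    calc ‖(ϖ : F)‖ ^ k ≤ ‖(ϖ : F)‖ ^ (1 : ℤ) :=
          zpow_le_zpow_right_of_le_one₀ (norm_units_pos ϖ) hϖ.norm_lt_one.le (by omega)
      _ = ‖(ϖ : F)‖ := zpow_one _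

omit [IsUltrametricDist F] in
/-- (Ported verbatim from the HodgeCMPerL package; no docstring in the source.) -/
theorem closedBall_norm_eq_ball_one : closedBall (0 : F) ‖(ϖ : F)‖ = ball (0 : F) 1 := by
  ext x
  rw [mem_closedBall_zero_iff, mem_ball_zero_iff]
  exact ⟨fun h => h.trans_lt hϖ.norm_lt_one, hϖ.norm_le_of_norm_lt_one x⟩

end IsUniformizer

/-! ### The shell partition: disjoint, measurable, translates of `𝒪^×`, equal Haar measure -/

omit [IsUltrametricDist F] in
/-- (Ported verbatim from the HodgeCMPerL package; no docstring in the source.) -/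
theorem pairwise_disjoint_shell (ϖ : Fˣ) (hϖ : ‖(ϖ : F)‖ < 1) :
    Pairwise (Function.onFun Disjoint (shell ϖ)) := by
  intro k l hkl
  change Disjoint (shell ϖ k) (shell ϖ l)
  rw [Set.disjoint_left]
  intro y hk hl
  rw [mem_shell_iff] at hk hl
  exact hkl (zpow_right_injective₀ (norm_units_pos ϖ) hϖ.ne (hk.symm.trans hl))

omit [IsUltrametricDist F] in
/-- (Ported verbatim from the HodgeCMPerL package; no docstring in the source.) -/
theorem isClosed_shell (ϖ : Fˣ) (k : ℤ) : IsClosed (shell ϖ k) :=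
  isClosed_eq (continuous_norm.comp Units.continuous_val) continuous_const

omit [IsUltrametricDist F] in
/-- `shell ϖ k = ϖᵏ • 𝒪^×` -/
theorem shell_eq_smul_shell_zero (ϖ : Fˣ) (k : ℤ) : shell ϖ k = ϖ ^ k • shell ϖ 0 := by
  ext y
  rw [Set.mem_smul_set]
  constructor
  · intro hy
    obtain ⟨u, hu, rfl⟩ := exists_eq_zpow_mul_of_norm_eq ϖ y k hy
    exact ⟨u, by rw [mem_shell_iff, zpow_zero]; exact hu, rfl⟩
  · rintro ⟨u, hu, rfl⟩
    rw [mem_shell_iff, zpow_zero] at hu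
    exact zpow_mul_mem_shell ϖ u hu k

attribute [local instance] unitsBorel borelSpace_units

omit [IsUltrametricDist F] in
/-- (Ported verbatim from the HodgeCMPerL package; no docstring in the source.) -/
theorem measurableSet_shell (ϖ : Fˣ) (k : ℤ) : MeasurableSet (shell ϖ k) := (isClosed_shell ϖ k).measurableSet

omit [IsUltrametricDist F] in
/-- all shells have the Haar measure of `𝒪^× = shell ϖ 0` (left invariance only) -/
theorem measure_shell_eq (μG : Measure Fˣ) [μG.IsMulLeftInvariant] (ϖ : Fˣ) (k : ℤ) :
    μG (shell ϖ k) = μG (shell ϖ 0) := by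
  rw [shell_eq_smul_shell_zero ϖ k, measure_smul]

end Ord

end DilationModel
end LocalFactors
end PerL34
end HodgeCM

end
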